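import Summits.AtomisticToContinuum.FouriersLaw.Theorems.PhononMeanFreePathCoherentDephasingWeakCouplingCorrelationDecay

/-!
# Equilibrium cross-correlations of the pinned chain at fixed length: continuity in time

Support file for the crux `PhononMeanFreePath.CoherentDephasing` (stmt-AtomisticToContinuum-11810), line `Sketch`
(coherent-field Beer–Lambert), stub `stub_responseRegularity` (continuity of the coherent response field
`t ↦ ∫ p₀ · (K_t g) dμ_T` for polynomial observables `g`): companion of
`PhononMeanFreePathCoherentDephasingWeakCouplingCorrelationDecay` (exponential decorrelation, measurability,
integrability of the same correlations). For the `n`-site chain `pinnedChain ω₂ lam β γ` (`n ≥ 1`,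
`ω₂, β, γ, T > 0`, `lam ≥ 0`), the Gibbs measure `μ_T = gibbsMeasure n T` and the CONSTRUCTED transition kernels
`K_u = transitionKernel n T T u⁺`, and two continuous observables `a` (weight) and `g` (propagated observable)
dominated by `e^{ϑH}` with `0 < ϑ`, `2ϑ < 1/T`:

* `pinnedChain_continuous_crossCorr` — `u ↦ ∫ a · (K_{u⁺} g) dμ_T` is continuous on `ℝ`.

Proof: the correlations `∫ a · K_u g^M dμ_T` of the bounded truncations `g^M = max(-M, min(M, g))` are continuous
(dominated convergence along the continuous paths of the constructed flow, weight `M |a| ∈ L¹(μ_T)`), and they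
converge to `∫ a · K_u g dμ_T` UNIFORMLY in `u`: by weighted AM–GM and the `L²(μ_T)`-contraction
`∫ (K_u f)² dμ_T ≤ ∫ f² dμ_T` (`pinnedChain_integral_sq_act_le`, Jensen + kernel Gibbs invariance),
`|∫ a · K_u (g - g^M) dμ_T| ≤ (ε ∫ a² dμ_T + ε⁻¹ ∫ (g - g^M)² dμ_T)/2`, and `∫ (g - g^M)² dμ_T → 0`. A uniform limit
of continuous functions is continuous. This generalises `pinnedChain_continuous_kinCorr` (KernelGibbsF, `a = g =
p₀² - T`) to two different unbounded observables; no self-adjointness of `K_u` is used. Nothing is uniform in `n`.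
-/

noncomputable section

open MeasureTheory ProbabilityTheory Filter Topology Set
open scoped NNReal

namespace Summit.AtomisticToContinuum.FouriersLaw.Theorems.CoherentDephasing

open Literature.MathematicalPhysics.KineticTheory.HeatConduction
open Literature.MathematicalPhysics.KineticTheory Literature.Probability.Process OscillatorChain
open Summit.AtomisticToContinuum.FouriersLaw.Theorems.SubdiffusiveBondHeat

/-- **Continuity in time of equilibrium cross-correlations.** For the `n`-site pinned chain (`n ≥ 1`,
`ω₂, β, γ, T > 0`, `lam ≥ 0`), `0 < ϑ` with `2ϑ < 1/T`, and continuous observables `a`, `g` with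
`|a| ≤ M_a e^{ϑH}`, `|g| ≤ M_g e^{ϑH}`, the correlation `u ↦ ∫ a · (K_{u⁺} g) dμ_T` is continuous on `ℝ`
(`K_u = transitionKernel n T T u`, `μ_T = gibbsMeasure n T`, real time clamped at `0⁺`): uniform limit of the
correlations of the bounded truncations `g^M = max(-M, min(M, g))` (continuous by dominated convergence along the
continuous flow), the error `|∫ a · K_u(g - g^M) dμ_T| ≤ (ε ∫ a² + ε⁻¹ ∫ (g - g^M)²)/2` being uniform in `u` by the
`L²(μ_T)`-contraction of `K_u`. All binders explicit (registered sub-goal of stmt-AtomisticToContinuum-11810).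
[folklore] -/
theorem pinnedChain_continuous_crossCorr :
    ∀ ω₂ lam β γ : ℝ, 0 < ω₂ → 0 ≤ lam → 0 < β → 0 < γ → ∀ n : ℕ, 0 < n → ∀ T : ℝ, 0 < T →
      ∀ ϑ : ℝ, 0 < ϑ → 2 * ϑ < 1 / T → ∀ (a g : PhaseSpace n → ℝ), Continuous a → Continuous g →
      ∀ Ma Mg : ℝ, (∀ y, |a y| ≤ Ma * Real.exp (ϑ * (pinnedChain ω₂ lam β γ).hamiltonian n y)) →
      (∀ y, |g y| ≤ Mg * Real.exp (ϑ * (pinnedChain ω₂ lam β γ).hamiltonian n y)) →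
      Continuous fun u : ℝ => ∫ z, a z *
          (∫ y, g y ∂((pinnedChain ω₂ lam β γ).transitionKernel n T T u.toNNReal z))
        ∂((pinnedChain ω₂ lam β γ).gibbsMeasure n T) := by
  intro ω₂ lam β γ hω hl hβ hγ n hn T hT ϑ hϑ0 h2ϑ a g ha hg Ma Mg haM hgM
  set P := pinnedChain ω₂ lam β γ with hP
  set μ := P.gibbsMeasure n T with hμ
  set κ : ℝ → Kernel (PhaseSpace n) (PhaseSpace n) := fun u => P.transitionKernel n T T u.toNNReal with hκ
  haveI : IsProbabilityMeasure μ := pinnedChain_isProbabilityMeasure_gibbsMeasure hω hl hβ.le γ n hT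
  haveI : ∀ u, IsMarkovKernel (κ u) := fun u =>
    pinnedChain_isMarkovKernel_transitionKernel hω hl hβ.le hγ.le n T T u.toNNReal
  have hϑ1 : ϑ < 1 / T := by linarith
  -- truncations of `g`
  set gM : ℕ → PhaseSpace n → ℝ := fun M z => max (-(M:ℝ)) (min (M:ℝ) (g z)) with hgM'
  have hgMc : ∀ M, Continuous (gM M) := fun M => continuous_const.max (continuous_const.min hg)
  have hgMb : ∀ M y, ‖gM M y‖ ≤ M := fun M y => by
    rw [Real.norm_eq_abs, abs_le]
    exact ⟨le_max_left _ _, max_le (by linarith [(M.cast_nonneg : (0:ℝ) ≤ M)]) (min_le_left _ _)⟩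
  have hdiffle : ∀ M y, |g y - gM M y| ≤ |g y| := fun M y => by
    simp only [hgM']
    rcases le_total 0 (g y) with h | h
    · have hmax : max (-(M:ℝ)) (min (M:ℝ) (g y)) = min (M:ℝ) (g y) :=
        max_eq_right (le_min (by linarith [(M.cast_nonneg : (0:ℝ) ≤ M)])
          (by linarith [(M.cast_nonneg : (0:ℝ) ≤ M)]))
      rw [hmax, abs_of_nonneg h]
      rcases le_total (M:ℝ) (g y) with h' | h'
      · rw [min_eq_left h', abs_of_nonneg (by linarith)]; linarith [(M.cast_nonneg : (0:ℝ) ≤ M)]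
      · rw [min_eq_right h', sub_self, abs_zero]; exact h
    · have : min (M:ℝ) (g y) = g y := min_eq_right (h.trans M.cast_nonneg)
      rw [this, abs_of_nonpos h]
      rcases le_total (-(M:ℝ)) (g y) with h' | h'
      · rw [max_eq_right h', sub_self, abs_zero]; linarith
      · rw [max_eq_left h', abs_of_nonpos (by linarith)]; linarith [(M.cast_nonneg : (0:ℝ) ≤ M)]
  have hdexp : ∀ M y, |g y - gM M y| ≤ Mg * Real.exp (ϑ * P.hamiltonian n y) := fun M y =>
    (hdiffle M y).trans (hgM y)
  -- bounded kernel actions of the truncations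
  have hin : ∀ (M : ℕ) (u : ℝ) (z : PhaseSpace n), ‖∫ y, gM M y ∂(κ u z)‖ ≤ M := fun M u z => by
    have := norm_integral_le_of_norm_le_const (μ := κ u z) (Eventually.of_forall (hgMb M))
    simpa [probReal_univ] using this
  -- `a ∈ L¹(μ_T) ∩ L²(μ_T)`
  have haint : Integrable a μ := integrable_of_abs_le_exp
    (pinnedChain_integrable_exp_mul_hamiltonian_gibbsMeasure hω hl hβ.le γ n hT hϑ1) ha haM
  have hA := pinnedChain_integral_sq_act_le hω hl hβ hγ hn hT hϑ0 h2ϑ ha haM 0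
  set A : ℝ := ∫ z, a z ^ 2 ∂μ with hAdef
  have hA0 : 0 ≤ A := integral_nonneg fun z => sq_nonneg _
  -- `δ M = ∫ (g - g^M)² dμ_T → 0`
  have hG := pinnedChain_integral_sq_act_le hω hl hβ hγ hn hT hϑ0 h2ϑ hg hgM 0
  set δ : ℕ → ℝ := fun M => ∫ z, (g z - gM M z) ^ 2 ∂μ with hδ
  have hδlim : Tendsto δ atTop (𝓝 0) := by
    have h0 : (0:ℝ) = ∫ z, (0:ℝ) ∂μ := by simp
    rw [h0]
    refine tendsto_integral_of_dominated_convergence (fun z => g z ^ 2)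
      (fun M => (((hg.sub (hgMc M)).pow 2)).aestronglyMeasurable) hG.1
      (fun M => Eventually.of_forall fun z => ?_) (Eventually.of_forall fun z => ?_)
    · rw [Real.norm_eq_abs, abs_pow, ← sq_abs (g z)]
      exact pow_le_pow_left₀ (abs_nonneg _) (hdiffle M z) 2
    · refine tendsto_const_nhds.congr' ?_
      obtain ⟨M₁, hM₁⟩ := exists_nat_ge |g z|
      filter_upwards [eventually_ge_atTop M₁] with M hM
      have hMr : |g z| ≤ M := hM₁.trans (by exact_mod_cast hM)
      have : gM M z = g z := by
        simp only [hgM']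
        rw [min_eq_right (abs_le.1 hMr).2, max_eq_right (abs_le.1 hMr).1]
      simp [this]
  -- the continuous approximants `K_M(u) = ∫ a · K_u g^M dμ_T`
  set K : ℝ → ℝ := fun u => ∫ z, a z * (∫ y, g y ∂(κ u z)) ∂μ with hK
  set KM : ℕ → ℝ → ℝ := fun M u => ∫ z, a z * (∫ y, gM M y ∂(κ u z)) ∂μ with hKM
  have hKMc : ∀ M, Continuous (KM M) := by
    intro M
    refine continuous_of_dominated (bound := fun z => ‖a z‖ * M) (fun u => ?_)
      (fun u => Eventually.of_forall fun z => ?_) (haint.norm.mul_const _) (Eventually.of_forall fun z => ?_)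
    · exact ha.aestronglyMeasurable.mul
        ((hgMc M).stronglyMeasurable.integral_kernel (κ := κ u)).aestronglyMeasurable
    · rw [norm_mul]
      exact mul_le_mul_of_nonneg_left (hin M u z) (norm_nonneg _)
    · exact continuous_const.mul
        (pinnedChain_continuous_integral_transitionKernel_time hω hl hβ hγ (hgMc M) (hgMb M) z)
  -- uniform approximation `K_M → K`
  have hunif : TendstoUniformly KM K atTop := by
    rw [Metric.tendstoUniformly_iff]
    intro η hη
    set ε : ℝ := η / (A + 1) with hε
    have hε0 : 0 < ε := by positivity
    have hδev : ∀ᶠ M in atTop, δ M < ε * η := (tendsto_order.1 hδlim).2 _ (by positivity)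
    filter_upwards [hδev] with M hM u
    rw [Real.dist_eq]
    set uu : ℝ≥0 := u.toNNReal with huu
    have hB := pinnedChain_integral_sq_act_le hω hl hβ hγ hn hT hϑ0 h2ϑ (f := fun y => g y - gM M y)
      (hg.sub (hgMc M)) (hdexp M) uu
    have hgκ : ∀ z, Integrable g (κ u z) := fun z => integrable_of_abs_le_exp
      (pinnedChain_integrable_exp_mul_hamiltonian_transitionKernel hω hl hT hβ.le hγ.le hn hϑ0 hϑ1 uu z) hg hgM
    have hgMκ : ∀ z, Integrable (gM M) (κ u z) := fun z =>
      (integrable_const (M:ℝ)).mono' (hgMc M).aestronglyMeasurable (Eventually.of_forall (hgMb M))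
    have hI0 : Integrable (fun z => a z * ∫ y, g y ∂(κ u z)) μ :=
      pinnedChain_integrable_weight_mul_act hω hl hβ hγ hn hT hϑ0 h2ϑ ha hg haM hgM uu
    have hIM : Integrable (fun z => a z * ∫ y, gM M y ∂(κ u z)) μ := by
      refine (haint.norm.mul_const (M:ℝ)).mono' (ha.aestronglyMeasurable.mul
        ((hgMc M).stronglyMeasurable.integral_kernel (κ := κ u)).aestronglyMeasurable)
        (Eventually.of_forall fun z => ?_)
      rw [norm_mul]
      exact mul_le_mul_of_nonneg_left (hin M u z) (norm_nonneg _)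
    have hdiff : K u - KM M u = ∫ z, a z * (∫ y, (g y - gM M y) ∂(κ u z)) ∂μ := by
      simp only [hK, hKM]
      rw [← integral_sub hI0 hIM]
      refine integral_congr_ae (Eventually.of_forall fun z => ?_)
      dsimp only
      rw [integral_sub (hgκ z) (hgMκ z)]
      ring
    have hT1 := abs_integral_mul_le_weighted hA.1 hB.2.1 hε0
    have hPd : ∫ z, (∫ y, (g y - gM M y) ∂(κ u z)) ^ 2 ∂μ ≤ δ M := hB.2.2
    have hεA : ε * A ≤ η := by
      rw [hε, div_mul_eq_mul_div, div_le_iff₀ (by positivity)]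
      nlinarith
    rw [hdiff]
    calc |∫ z, a z * (∫ y, (g y - gM M y) ∂(κ u z)) ∂μ|
        ≤ (ε * A + ε⁻¹ * ∫ z, (∫ y, (g y - gM M y) ∂(κ u z)) ^ 2 ∂μ) / 2 := hT1
      _ ≤ (ε * A + ε⁻¹ * δ M) / 2 := by gcongr
      _ < (ε * A + ε⁻¹ * (ε * η)) / 2 := by gcongr
      _ = (ε * A + η) / 2 := by rw [← mul_assoc, inv_mul_cancel₀ hε0.ne', one_mul]
      _ ≤ η := by linarith
  exact hunif.continuous (Frequently.of_forall hKMc)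

end Summit.AtomisticToContinuum.FouriersLaw.Theorems.CoherentDephasing

end
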